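import Literature.Analysis.FluidPDE.ElgindiWordCalculus
import HarnessLib

/-!
# Leibniz formulas for the words `D_θ^iD_z^j` of a product
([ElgindiGhoulMasmoudi2021] §9, proof of Proposition 9.2: "if we take four derivatives of the
product `fg`, one of the two must always have at most two derivatives on it")

Topic `Literature/Analysis/FluidPDE`. Support file (definitions with bodies and proved theorems, no
named facts) on the proof path of the named fact
`Literature.Analysis.FluidPDE.Elgindi.ElgindiGhoulMasmoudi2021_stabilityCore`
(`ElgindiStabilityDecomposition.lean`). Elgindi–Ghoul–Masmoudi, arXiv:1910.14071, §9 (p. 20).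

For smooth `f, g : ℝ² → ℝ` (curried, `Smooth2`): `D_z(fg) = (D_zf)g + fD_zg`,
`D_θ(fg) = (D_θf)g + fD_θg`, the binomial formulas for `D_z^n(fg)` and `D_θ^n(fg)`, and the double
binomial formula `D_θ^iD_z^j(fg) = Σ_{l≤i}Σ_{k≤j} C(i,l)C(j,k)(D_θ^lD_z^kf)(D_θ^{i−l}D_z^{j−k}g)`
(`iterate_Dθ_Dz_mul`), as global pointwise identities.
-/

noncomputable section

open Set Function Real Filter Finset
open _root_.Topology

namespace Literature.Analysis.FluidPDE

namespace Elgindi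

/-! ### Smooth functions of two variables and their slices -/

/-- Smooth (all orders) functions of two variables, curried. [folklore] -/
def Smooth2 (f : ℝ → ℝ → ℝ) : Prop := ∀ n : ℕ, ContDiff ℝ n (uncurry f)

namespace Smooth2

variable {f g : ℝ → ℝ → ℝ}

/-- `z`-slices are differentiable with derivative `∂_zf`. [folklore] -/
theorem hasDerivAt_z (hf : Smooth2 f) (z θ : ℝ) : HasDerivAt (fun z' => f z' θ) (dz f z θ) z := by
  have hd : DifferentiableAt ℝ (uncurry f) (z, θ) := (hf 1).differentiable (by simp) _
  have hc : DifferentiableAt ℝ (fun z' : ℝ => ((z', θ) : ℝ × ℝ)) z := differentiableAt_id.prodMk (differentiableAt_const θ)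
  have : DifferentiableAt ℝ (fun z' => f z' θ) z := DifferentiableAt.comp (g := uncurry f) z hd hc
  exact this.hasDerivAt

/-- `θ`-slices are differentiable with derivative `∂_θf`. [folklore] -/
theorem hasDerivAt_θ (hf : Smooth2 f) (z θ : ℝ) : HasDerivAt (fun θ' => f z θ') (dθ f z θ) θ := by
  have hd : DifferentiableAt ℝ (uncurry f) (z, θ) := (hf 1).differentiable (by simp) _
  have hc : DifferentiableAt ℝ (fun θ' : ℝ => ((z, θ') : ℝ × ℝ)) θ := (differentiableAt_const z).prodMk differentiableAt_id
  have : DifferentiableAt ℝ (fun θ' => f z θ') θ := DifferentiableAt.comp (g := uncurry f) θ hd hc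
  exact this.hasDerivAt

/-- Closure under `D_z`. [folklore] -/
theorem ofDz (hf : Smooth2 f) : Smooth2 (Dz f) := fun n => contDiff_Dz_of_contDiff (hf (n + 1))

/-- Closure under `D_θ`. [folklore] -/
theorem ofDθ (hf : Smooth2 f) : Smooth2 (Dθ f) := fun n => contDiff_Dθ_of_contDiff (hf (n + 1))

/-- Closure under iterates of `D_z`. [folklore] -/
theorem ofIterDz (hf : Smooth2 f) (j : ℕ) : Smooth2 (Dz^[j] f) := by
  induction j generalizing f with
  | zero => exact hf
  | succ j ih => rw [Function.iterate_succ]; exact ih hf.ofDz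

/-- Closure under iterates of `D_θ`. [folklore] -/
theorem ofIterDθ (hf : Smooth2 f) (i : ℕ) : Smooth2 (Dθ^[i] f) := by
  induction i generalizing f with
  | zero => exact hf
  | succ i ih => rw [Function.iterate_succ]; exact ih hf.ofDθ

/-- Closure under products. [folklore] -/
theorem ofMul (hf : Smooth2 f) (hg : Smooth2 g) : Smooth2 (f * g) := fun n => by
  have := (hf n).mul (hg n)
  exact this

/-- Closure under the words. [folklore] -/
theorem ofWord (hf : Smooth2 f) (i j : ℕ) : Smooth2 (Dθ^[i] (Dz^[j] f)) := (hf.ofIterDz j).ofIterDθ i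

end Smooth2

/-! ### First-order product rules -/

/-- **`D_z(fg) = (D_zf)g + fD_zg`** (pointwise, smooth `f, g`). [folklore] -/
theorem Dz_mul_apply {f g : ℝ → ℝ → ℝ} (hf : Smooth2 f) (hg : Smooth2 g) (z θ : ℝ) :
    Dz (f * g) z θ = Dz f z θ * g z θ + f z θ * Dz g z θ := by
  have h := (hf.hasDerivAt_z z θ).mul (hg.hasDerivAt_z z θ)
  have h' : HasDerivAt (fun z' => (f * g) z' θ) (dz f z θ * g z θ + f z θ * dz g z θ) z := h
  rw [Dz_eq_mul_dz, dz, h'.deriv, Dz_eq_mul_dz, Dz_eq_mul_dz]; ring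

/-- **`D_θ(fg) = (D_θf)g + fD_θg`** (pointwise, smooth `f, g`). [folklore] -/
theorem Dθ_mul_apply {f g : ℝ → ℝ → ℝ} (hf : Smooth2 f) (hg : Smooth2 g) (z θ : ℝ) :
    Dθ (f * g) z θ = Dθ f z θ * g z θ + f z θ * Dθ g z θ := by
  have h := (hf.hasDerivAt_θ z θ).mul (hg.hasDerivAt_θ z θ)
  have h' : HasDerivAt (fun θ' => (f * g) z θ') (dθ f z θ * g z θ + f z θ * dθ g z θ) θ := h
  rw [Dθ_apply, h'.deriv, Dθ_apply, Dθ_apply]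
  show Real.sin (2 * θ) * (deriv (fun θ' => f z θ') θ * g z θ + f z θ * deriv (fun θ' => g z θ') θ) = _
  rw [show deriv (fun θ' => f z θ') θ = dθ f z θ from rfl, show deriv (fun θ' => g z θ') θ = dθ g z θ from rfl]; ring

/-! ### Binomial formulas -/

/-- **`D_z^n(fg) = Σ_{k≤n} C(n,k)(D_z^kf)(D_z^{n−k}g)`** (pointwise, smooth `f, g`). [folklore] -/
theorem iterate_Dz_mul_apply {f g : ℝ → ℝ → ℝ} (hf : Smooth2 f) (hg : Smooth2 g) (n : ℕ) :
    ∀ z θ, (Dz^[n] (f * g)) z θ = ∑ k ∈ range (n + 1), (n.choose k : ℝ) * ((Dz^[k] f) z θ * (Dz^[n - k] g) z θ) := by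
  induction n with
  | zero => intro z θ; simp
  | succ n ih =>
    intro z θ
    set G : ℝ → ℝ → ℝ := fun z θ => ∑ k ∈ range (n + 1), (n.choose k : ℝ) * ((Dz^[k] f) z θ * (Dz^[n - k] g) z θ) with hG
    have eG : Dz^[n] (f * g) = G := by funext z θ; exact ih z θ
    rw [Function.iterate_succ_apply', eG]
    have hterm : ∀ k ∈ range (n + 1), HasDerivAt (fun z' => (n.choose k : ℝ) * ((Dz^[k] f) z' θ * (Dz^[n - k] g) z' θ))
        ((n.choose k : ℝ) * (dz (Dz^[k] f) z θ * (Dz^[n - k] g) z θ + (Dz^[k] f) z θ * dz (Dz^[n - k] g) z θ)) z := by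
      intro k _
      exact (((hf.ofIterDz k).hasDerivAt_z z θ).mul ((hg.ofIterDz (n - k)).hasDerivAt_z z θ)).const_mul _
    have hsum : HasDerivAt (fun z' => G z' θ)
        (∑ k ∈ range (n + 1), (n.choose k : ℝ) * (dz (Dz^[k] f) z θ * (Dz^[n - k] g) z θ + (Dz^[k] f) z θ * dz (Dz^[n - k] g) z θ)) z := by
      have := HasDerivAt.sum hterm
      refine this.congr_of_eventuallyEq (Eventually.of_forall fun z' => ?_)
      simp [hG, Finset.sum_apply]
    rw [Dz_eq_mul_dz, dz, hsum.deriv, Finset.mul_sum]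
    have key : ∀ k ∈ range (n + 1),
        z * ((n.choose k : ℝ) * (dz (Dz^[k] f) z θ * (Dz^[n - k] g) z θ + (Dz^[k] f) z θ * dz (Dz^[n - k] g) z θ)) =
        (n.choose k : ℝ) * ((Dz^[k + 1] f) z θ * (Dz^[n - k] g) z θ) + (n.choose k : ℝ) * ((Dz^[k] f) z θ * (Dz^[n + 1 - k] g) z θ) := by
      intro k hk
      have hk' : k ≤ n := Nat.lt_succ_iff.mp (mem_range.mp hk)
      have e : n + 1 - k = (n - k) + 1 := by omega
      rw [e, Function.iterate_succ_apply', Function.iterate_succ_apply', Dz_eq_mul_dz, Dz_eq_mul_dz]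
      ring
    rw [Finset.sum_congr rfl key, Finset.sum_add_distrib,
      Finset.sum_choose_succ_mul (fun k m => (Dz^[k] f) z θ * (Dz^[m] g) z θ) n, add_comm]

/-- **`D_θ^n(fg) = Σ_{k≤n} C(n,k)(D_θ^kf)(D_θ^{n−k}g)`** (pointwise, smooth `f, g`). [folklore] -/
theorem iterate_Dθ_mul_apply {f g : ℝ → ℝ → ℝ} (hf : Smooth2 f) (hg : Smooth2 g) (n : ℕ) :
    ∀ z θ, (Dθ^[n] (f * g)) z θ = ∑ k ∈ range (n + 1), (n.choose k : ℝ) * ((Dθ^[k] f) z θ * (Dθ^[n - k] g) z θ) := by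
  induction n with
  | zero => intro z θ; simp
  | succ n ih =>
    intro z θ
    set G : ℝ → ℝ → ℝ := fun z θ => ∑ k ∈ range (n + 1), (n.choose k : ℝ) * ((Dθ^[k] f) z θ * (Dθ^[n - k] g) z θ) with hG
    have eG : Dθ^[n] (f * g) = G := by funext z θ; exact ih z θ
    rw [Function.iterate_succ_apply', eG]
    have hterm : ∀ k ∈ range (n + 1), HasDerivAt (fun θ' => (n.choose k : ℝ) * ((Dθ^[k] f) z θ' * (Dθ^[n - k] g) z θ'))
        ((n.choose k : ℝ) * (dθ (Dθ^[k] f) z θ * (Dθ^[n - k] g) z θ + (Dθ^[k] f) z θ * dθ (Dθ^[n - k] g) z θ)) θ := by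
      intro k _
      exact (((hf.ofIterDθ k).hasDerivAt_θ z θ).mul ((hg.ofIterDθ (n - k)).hasDerivAt_θ z θ)).const_mul _
    have hsum : HasDerivAt (fun θ' => G z θ')
        (∑ k ∈ range (n + 1), (n.choose k : ℝ) * (dθ (Dθ^[k] f) z θ * (Dθ^[n - k] g) z θ + (Dθ^[k] f) z θ * dθ (Dθ^[n - k] g) z θ)) θ := by
      have := HasDerivAt.sum hterm
      refine this.congr_of_eventuallyEq (Eventually.of_forall fun θ' => ?_)
      simp [hG, Finset.sum_apply]
    rw [Dθ_apply, show deriv (fun θ' => G z θ') θ = _ from hsum.deriv, Finset.mul_sum]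
    have key : ∀ k ∈ range (n + 1),
        Real.sin (2 * θ) * ((n.choose k : ℝ) * (dθ (Dθ^[k] f) z θ * (Dθ^[n - k] g) z θ + (Dθ^[k] f) z θ * dθ (Dθ^[n - k] g) z θ)) =
        (n.choose k : ℝ) * ((Dθ^[k + 1] f) z θ * (Dθ^[n - k] g) z θ) + (n.choose k : ℝ) * ((Dθ^[k] f) z θ * (Dθ^[n + 1 - k] g) z θ) := by
      intro k hk
      have hk' : k ≤ n := Nat.lt_succ_iff.mp (mem_range.mp hk)
      have e : n + 1 - k = (n - k) + 1 := by omega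
      rw [e, Function.iterate_succ_apply', Function.iterate_succ_apply', Dθ_apply, Dθ_apply]
      show _ = (n.choose k : ℝ) * ((Real.sin (2 * θ) * dθ (Dθ^[k] f) z θ) * (Dθ^[n - k] g) z θ) +
        (n.choose k : ℝ) * ((Dθ^[k] f) z θ * (Real.sin (2 * θ) * dθ (Dθ^[n - k] g) z θ))
      ring
    rw [Finset.sum_congr rfl key, Finset.sum_add_distrib,
      Finset.sum_choose_succ_mul (fun k m => (Dθ^[k] f) z θ * (Dθ^[m] g) z θ) n, add_comm]

/-! ### `D_θ^i` of finite sums and the double binomial formula -/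

/-- `D_θ^i(c·fg)` for smooth `f, g` and a constant `c`: `= c·Σ_l C(i,l)(D_θ^lf)(D_θ^{i−l}g)`. [folklore] -/
theorem iterate_Dθ_const_mul_mul_apply {f g : ℝ → ℝ → ℝ} (hf : Smooth2 f) (hg : Smooth2 g) (c : ℝ) (i : ℕ) (z θ : ℝ) :
    (Dθ^[i] fun z θ => c * (f z θ * g z θ)) z θ = c * ∑ l ∈ range (i + 1), (i.choose l : ℝ) * ((Dθ^[l] f) z θ * (Dθ^[i - l] g) z θ) := by
  have e : (fun z θ => c * (f z θ * g z θ)) = c • (f * g) := by funext z θ; simp [smul_eq_mul]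
  rw [e, iterate_Dθ_smul]
  show c * (Dθ^[i] (f * g)) z θ = _
  rw [iterate_Dθ_mul_apply hf hg i z θ]

/-- `D_θ(f + g) = D_θf + D_θg` for smooth `f, g` (as functions). [folklore] -/
theorem Dθ_add_fun {f g : ℝ → ℝ → ℝ} (hf : Smooth2 f) (hg : Smooth2 g) : Dθ (f + g) = Dθ f + Dθ g := by
  funext z θ
  have h : HasDerivAt (fun θ' => (f + g) z θ') (dθ f z θ + dθ g z θ) θ := (hf.hasDerivAt_θ z θ).add (hg.hasDerivAt_θ z θ)
  rw [Dθ_apply, h.deriv]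
  show Real.sin (2 * θ) * (dθ f z θ + dθ g z θ) = Dθ f z θ + Dθ g z θ
  rw [Dθ_apply, Dθ_apply]
  show _ = Real.sin (2 * θ) * dθ f z θ + Real.sin (2 * θ) * dθ g z θ
  ring

/-- Closure of `Smooth2` under sums. [folklore] -/
theorem Smooth2.ofAdd {f g : ℝ → ℝ → ℝ} (hf : Smooth2 f) (hg : Smooth2 g) : Smooth2 (f + g) := fun n => by
  have := (hf n).add (hg n); exact this

/-- `D_θ^i(f + g) = D_θ^if + D_θ^ig` for smooth `f, g` (as functions). [folklore] -/
theorem iterate_Dθ_add_fun {f g : ℝ → ℝ → ℝ} (hf : Smooth2 f) (hg : Smooth2 g) (i : ℕ) : Dθ^[i] (f + g) = Dθ^[i] f + Dθ^[i] g := by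
  induction i generalizing f g with
  | zero => rfl
  | succ i ih => rw [Function.iterate_succ_apply, Dθ_add_fun hf hg, ih hf.ofDθ hg.ofDθ, Function.iterate_succ_apply, Function.iterate_succ_apply]

/-- `D_θ^i 0 = 0`. [folklore] -/
theorem iterate_Dθ_zero_fun (i : ℕ) : Dθ^[i] (0 : ℝ → ℝ → ℝ) = 0 := by
  induction i with
  | zero => rfl
  | succ i ih =>
    rw [Function.iterate_succ_apply', ih]
    funext z θ; simp [Dθ_apply]

/-- `D_θ^i` of a finite sum of smooth functions (as functions). [folklore] -/
theorem iterate_Dθ_finsetSum_fun {ι : Type*} (s : Finset ι) {F : ι → ℝ → ℝ → ℝ} (hF : ∀ k ∈ s, Smooth2 (F k)) (i : ℕ) :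
    Dθ^[i] (∑ k ∈ s, F k) = ∑ k ∈ s, Dθ^[i] (F k) := by
  classical
  induction s using Finset.induction_on with
  | empty => simp only [Finset.sum_empty]; exact iterate_Dθ_zero_fun i
  | insert a s ha ih =>
    have hFa : Smooth2 (F a) := hF a (Finset.mem_insert_self a s)
    have hFs : ∀ k ∈ s, Smooth2 (F k) := fun k hk => hF k (Finset.mem_insert_of_mem hk)
    have hS : Smooth2 (∑ k ∈ s, F k) := by
      intro n
      have : uncurry (∑ k ∈ s, F k) = fun p => ∑ k ∈ s, uncurry (F k) p := by
        funext p; simp [uncurry, Finset.sum_apply]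
      rw [this]; exact ContDiff.sum fun k hk => hFs k hk n
    rw [Finset.sum_insert ha, Finset.sum_insert ha, iterate_Dθ_add_fun hFa hS i, ih hFs]

/-- **The double binomial formula**: for smooth `f, g`,
`D_θ^iD_z^j(fg) = Σ_{k≤j}Σ_{l≤i} C(j,k)C(i,l)·(D_θ^lD_z^kf)(D_θ^{i−l}D_z^{j−k}g)` (pointwise). [cite: ElgindiGhoulMasmoudi2021, §9 proof of Proposition 9.2 (p. 20 of arXiv:1910.14071)] -/
theorem iterate_Dθ_Dz_mul_apply {f g : ℝ → ℝ → ℝ} (hf : Smooth2 f) (hg : Smooth2 g) (i j : ℕ) (z θ : ℝ) :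
    (Dθ^[i] (Dz^[j] (f * g))) z θ = ∑ k ∈ range (j + 1), ∑ l ∈ range (i + 1),
      ((j.choose k : ℝ) * (i.choose l : ℝ)) * ((Dθ^[l] (Dz^[k] f)) z θ * (Dθ^[i - l] (Dz^[j - k] g)) z θ) := by
  -- `D_z^j(fg)` as a finite sum of smooth products
  have e1 : Dz^[j] (f * g) = ∑ k ∈ range (j + 1), (fun z θ => (j.choose k : ℝ) * ((Dz^[k] f) z θ * (Dz^[j - k] g) z θ)) := by
    funext z θ; rw [iterate_Dz_mul_apply hf hg j z θ]; simp [Finset.sum_apply]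
  have hsm : ∀ k ∈ range (j + 1), Smooth2 (fun z θ => (j.choose k : ℝ) * ((Dz^[k] f) z θ * (Dz^[j - k] g) z θ)) := by
    intro k _ n
    have := ((hf.ofIterDz k).ofMul (hg.ofIterDz (j - k))) n
    exact contDiff_const.mul this
  rw [e1, iterate_Dθ_finsetSum_fun _ hsm i]
  simp only [Finset.sum_apply]
  refine Finset.sum_congr rfl fun k _ => ?_
  rw [iterate_Dθ_const_mul_mul_apply (hf.ofIterDz k) (hg.ofIterDz (j - k)) _ i z θ, Finset.mul_sum]
  refine Finset.sum_congr rfl fun l _ => ?_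
  ring

end Elgindi

end Literature.Analysis.FluidPDE
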